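import Summits.ValiantsHypothesis.ValiantsHypothesis.Theorems.KPlusLogSqLawTridiagonalRealStaticLadderMoves
import Summits.ValiantsHypothesis.ValiantsHypothesis.Theorems.KPlusLogSqLawTridiagonalRealStaticPumpHarvestPos
import Summits.ValiantsHypothesis.ValiantsHypothesis.Theorems.KPlusLogSqLawTridiagonalRealStaticPotentialRow

/-!
# Route «KPlusLogSqLaw», crux `WeakLifting` (stmt-ValiantsHypothesis-19561) — REAL side of the tridiagonal sector:
# the ROW STEP LAW — a certified row of the α register propagates one size up with one more zero («seed and switch», all sizes)

HONEST FRAMING.  Helper (`--supports stmt-ValiantsHypothesis-19561 --as helper`), seat val-sym-lift-p3 (g13), cell `pub-symmetroid`, 2026-08-28,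
α register (static definite symmetric tridiagonal monomial designs), LOWER side.  This is the all-sizes form of the mechanism behind the seat's rows
`…TridiagonalRealStaticSixNine/SevenTen/EightEleven/NineTwelve/NineThirteen/ThirteenTwenty`: in the continuant currency `pathDet a d b f` of
`…TridiagonalRealStaticPotentialDefs` (diagonal `a_t X^{d_t}`, links `b_t X^{f_t}`), IF the top continuant `D_{m+1}` alternates in sign along positive
points `l ++ [ρ]` (a row certificate: `|l|` zeros), keeps its sign from `ρ` to a further point `σ > ρ`, and has at `σ` the SAME sign as `D_m`, THEN
appending ONE vertex (diagonal entry `1`, link `β X^F`, produced by lift-p1 g11/g12's finite-slope move `StaticTridiagonalRealLadder.exists_move_signs_sq`)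
gives a design of size `m + 2` whose determinant alternates along `l ++ [ρ, σ]`: `|l| + 1` certified zeros (`row_step`).  In words: **every kernel row
`B m ≥ Z` whose certificate can be closed by one agreeing point yields `B (m+1) ≥ Z + 1`** — the switch of the new edge is placed beyond all certified
zeros, where it costs nothing and creates one transition zero.  Nothing here is an upper bound; the agreeing point is a genuine hypothesis (a `2 × 2` design
with `d₀ + d₁ = 2f₀` and `a₀a₁ < b₀²` has `D₂ < 0 < D₁` everywhere); nothing bears on `WeakLifting` / `TropicalB` (stmt-19771) in their windows, on
Conjecture B, the Door-A registers, `MatrixDescartes` (stmt-ValiantsHypothesis-18050) or VP ≠ VNP.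
[mechanism: this seat's seed-and-switch; tools: lift-p1 g11/g12 `exists_move_signs_sq`, `le_card_posRoots_of_isChain`; folklore continuants]
-/

-- `Summit.ValiantsHypothesis.ValiantsHypothesis.…` repeats a component by the D-0017 layout (single-conjunct summit); the name is mandated.
set_option linter.dupNamespace false
set_option autoImplicit false

namespace Summit.ValiantsHypothesis.ValiantsHypothesis.Theorems.KPlusLogSqLaw.StaticTridiagonalRealRowStep

open Polynomial
open Summit.ValiantsHypothesis.ValiantsHypothesis.Theorems.KPlusLogSqLaw.StaticTridiagonalRealPotential
  (pathDet pathDet_add_two pathDet_congr)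
open Summit.ValiantsHypothesis.ValiantsHypothesis.Theorems.KPlusLogSqLaw.StaticTridiagonalRealLadder
  (exists_move_signs_sq le_card_posRoots_of_isChain ne_zero_of_isChain_alt isChain_alt_congr lt_last_of_isChain)

/-- Along an alternation list with at least two entries the function vanishes nowhere (length form of
`StaticTridiagonalRealLadder.ne_zero_of_isChain_alt`). [folklore] -/
theorem ne_zero_of_isChain_alt_of_two_le {φ : ℝ → ℝ} {L : List ℝ} (h : L.IsChain (fun x y => φ x * φ y < 0))
    (hL : 2 ≤ L.length) : ∀ x ∈ L, φ x ≠ 0 := by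
  match L, h, hL with
  | [], _, hL => simp at hL
  | [_], _, hL => simp at hL
  | _ :: _ :: _, h, _ => exact ne_zero_of_isChain_alt h

/-- **ROW STEP LAW (seed and switch, all sizes).**  Let `D_k = pathDet a d b f k`.  Suppose `D_{m+1}` alternates in sign along the positive,
strictly increasing points `l ++ [ρ]`, that `D_{m+1}(ρ) · D_{m+1}(σ) > 0` for a further point `σ > ρ`, and that `D_{m+1}(σ) · D_m(σ) > 0`.  Then for
some exponent `F` and some `β > 0` the design extended by the vertex `m + 1` with diagonal entry `1 · X⁰` and link `β · X^F` (to the vertex `m`) has a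
determinant `D_{m+2}` that alternates along `l ++ [ρ, σ]`; hence it has at least `|l| + 1` distinct positive zeros — one more than the row certified
by `l ++ [ρ]`.  (`D_{m+2} = D_{m+1} − β² X^{2F} D_m` copies the sign of `D_{m+1}` on `l ++ [ρ]` and the sign of `−D_m` at `σ`.)
[this seat's seed-and-switch via lift-p1's `exists_move_signs_sq`] -/
theorem row_step (a : ℕ → ℝ) (d : ℕ → ℕ) (b : ℕ → ℝ) (f : ℕ → ℕ) (m : ℕ) (l : List ℝ) (ρ σ : ℝ)
    (hchain : (l ++ ρ :: [σ]).IsChain (· < ·)) (hpos : ∀ x ∈ l ++ [ρ], 0 < x)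
    (halt : (l ++ [ρ]).IsChain (fun x y => (pathDet a d b f (m + 1)).eval x * (pathDet a d b f (m + 1)).eval y < 0))
    (hρσ : 0 < (pathDet a d b f (m + 1)).eval ρ * (pathDet a d b f (m + 1)).eval σ)
    (hagree : 0 < (pathDet a d b f (m + 1)).eval σ * (pathDet a d b f m).eval σ) :
    ∃ (F : ℕ) (β : ℝ), 0 < β ∧
      (l ++ ρ :: [σ]).IsChain (fun x y =>
        (pathDet (fun t => if t = m + 1 then 1 else a t) (fun t => if t = m + 1 then 0 else d t)
            (fun t => if t = m then β else b t) (fun t => if t = m then F else f t) (m + 2)).eval x *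
          (pathDet (fun t => if t = m + 1 then 1 else a t) (fun t => if t = m + 1 then 0 else d t)
            (fun t => if t = m then β else b t) (fun t => if t = m then F else f t) (m + 2)).eval y < 0) ∧
      l.length + 1 ≤ ((pathDet (fun t => if t = m + 1 then 1 else a t) (fun t => if t = m + 1 then 0 else d t)
            (fun t => if t = m then β else b t) (fun t => if t = m then F else f t) (m + 2)).roots.toFinset.filter
          (fun t => 0 < t)).card := by
  -- order facts
  have hsplit := List.isChain_split.mp hchain
  have hlρ : (l ++ [ρ]).IsChain (· < ·) := hsplit.1
  have hρσ' : ρ < σ := (List.isChain_cons_cons.mp hsplit.2).1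
  have hl_lt : ∀ u ∈ l, u < ρ := lt_last_of_isChain hlρ
  have hρpos : 0 < ρ := hpos ρ (by simp)
  have hσpos : 0 < σ := hρpos.trans hρσ'
  have hpρ : (pathDet a d b f (m + 1)).eval ρ ≠ 0 := fun h0 => by
    rw [h0, zero_mul] at hρσ; exact lt_irrefl _ hρσ
  have hqσ : (pathDet a d b f m).eval σ ≠ 0 := fun h0 => by
    rw [h0, mul_zero] at hagree; exact lt_irrefl _ hagree
  -- the top continuant vanishes at no certificate point
  have hpne : ∀ x ∈ l ++ [ρ], (pathDet a d b f (m + 1)).eval x ≠ 0 := by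
    intro x hx
    by_cases hl : l = []
    · subst hl
      simp only [List.nil_append, List.mem_singleton] at hx
      subst hx
      exact hpρ
    · have h2 : 2 ≤ (l ++ [ρ]).length := by
        rw [List.length_append, List.length_singleton]
        have : 0 < l.length := List.length_pos_of_ne_nil hl
        omega
      exact ne_zero_of_isChain_alt_of_two_le halt h2 x hx
  -- the finite-slope move of lift-p1: `h = p − κ x^{2F} q` has the sign of `p = D_{m+1}` on `l ++ [ρ]` and of `−q = −D_m` at `σ`
  obtain ⟨F, κ, hκ, hxs, hys⟩ := exists_move_signs_sq (fun x => (pathDet a d b f (m + 1)).eval x)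
    (fun x => (pathDet a d b f m).eval x) (l ++ [ρ]).toFinset {σ} hρpos hρσ'
    (fun x hx => by
      have hx' : x ∈ l ++ [ρ] := List.mem_toFinset.mp hx
      refine ⟨hpos x hx', ?_, hpne x hx'⟩
      rcases List.mem_append.mp hx' with h1 | h1
      · exact (hl_lt x h1).le
      · rw [List.mem_singleton] at h1; rw [h1])
    (fun y hy => by
      rw [Finset.mem_singleton] at hy
      subst hy
      exact ⟨le_rfl, hqσ⟩)
  refine ⟨F, Real.sqrt κ, Real.sqrt_pos.mpr hκ, ?_⟩
  -- the new top continuant evaluates to `D_{m+1}(x) − κ x^{2F} D_m(x)`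
  have hP1 : pathDet (fun t => if t = m + 1 then 1 else a t) (fun t => if t = m + 1 then 0 else d t)
      (fun t => if t = m then Real.sqrt κ else b t) (fun t => if t = m then F else f t) (m + 1) = pathDet a d b f (m + 1) :=
    pathDet_congr (fun t ht => by rw [if_neg (by omega)]) (fun t ht => by rw [if_neg (by omega)])
      (fun t ht => by rw [if_neg (by omega)]) (fun t ht => by rw [if_neg (by omega)])
  have hP0 : pathDet (fun t => if t = m + 1 then 1 else a t) (fun t => if t = m + 1 then 0 else d t)
      (fun t => if t = m then Real.sqrt κ else b t) (fun t => if t = m then F else f t) m = pathDet a d b f m :=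
    pathDet_congr (fun t ht => by rw [if_neg (by omega)]) (fun t ht => by rw [if_neg (by omega)])
      (fun t ht => by rw [if_neg (by omega)]) (fun t ht => by rw [if_neg (by omega)])
  have hev : ∀ x : ℝ, (pathDet (fun t => if t = m + 1 then 1 else a t) (fun t => if t = m + 1 then 0 else d t)
      (fun t => if t = m then Real.sqrt κ else b t) (fun t => if t = m then F else f t) (m + 2)).eval x =
        (pathDet a d b f (m + 1)).eval x - κ * x ^ (2 * F) * (pathDet a d b f m).eval x := by
    intro x
    rw [pathDet_add_two, hP1, hP0]
    have e1 : (if m + 1 = m + 1 then (1 : ℝ) else a (m + 1)) = 1 := if_pos rfl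
    have e2 : (if m + 1 = m + 1 then (0 : ℕ) else d (m + 1)) = 0 := if_pos rfl
    have e3 : (if m = m then Real.sqrt κ else b m) = Real.sqrt κ := if_pos rfl
    have e4 : (if m = m then F else f m) = F := if_pos rfl
    rw [e1, e2, e3, e4]
    simp only [eval_sub, eval_mul, eval_pow, eval_C, eval_X, map_one, eval_one]
    rw [mul_pow, Real.sq_sqrt hκ.le]
    ring
  -- alternation along `l ++ [ρ, σ]`
  have hnew : (l ++ ρ :: [σ]).IsChain (fun x y =>
      (pathDet (fun t => if t = m + 1 then 1 else a t) (fun t => if t = m + 1 then 0 else d t)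
        (fun t => if t = m then Real.sqrt κ else b t) (fun t => if t = m then F else f t) (m + 2)).eval x *
      (pathDet (fun t => if t = m + 1 then 1 else a t) (fun t => if t = m + 1 then 0 else d t)
        (fun t => if t = m then Real.sqrt κ else b t) (fun t => if t = m then F else f t) (m + 2)).eval y < 0) := by
    rw [List.isChain_split]
    constructor
    · refine (isChain_alt_congr (c := 1) (f := fun x => (pathDet a d b f (m + 1)).eval x) fun x hx => ?_).mp halt
      rw [one_mul, hev x]
      have h1 := hxs x (List.mem_toFinset.mpr hx)
      linarith [h1]
    · refine List.isChain_cons_cons.mpr ⟨?_, List.isChain_singleton _⟩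
      rw [hev ρ, hev σ]
      have h1 := hxs ρ (List.mem_toFinset.mpr (by simp))
      have h2 := hys σ (Finset.mem_singleton_self σ)
      refine lt_of_not_ge fun H => ?_
      nlinarith [mul_pos (mul_pos h1 h2) (mul_pos hρσ hagree),
        mul_nonneg H (sq_nonneg ((pathDet a d b f (m + 1)).eval ρ * (pathDet a d b f (m + 1)).eval σ *
          (pathDet a d b f m).eval σ))]
  refine ⟨hnew, ?_⟩
  have hposall : ∀ x ∈ l ++ ρ :: [σ], 0 < x := by
    intro x hx
    rcases List.mem_append.mp hx with h1 | h1
    · exact hpos x (List.mem_append_left _ h1)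
    · simp only [List.mem_cons, List.not_mem_nil, or_false] at h1
      rcases h1 with rfl | rfl
      · exact hρpos
      · exact hσpos
  have hcount := le_card_posRoots_of_isChain _ (l ++ ρ :: [σ]) hchain hposall hnew
  simp only [List.length_append, List.length_cons, List.length_nil] at hcount
  omega

end Summit.ValiantsHypothesis.ValiantsHypothesis.Theorems.KPlusLogSqLaw.StaticTridiagonalRealRowStep
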